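import Literature.IUT.HodgeTheaters.PMBaseKitModel
import Literature.IUT.HodgeTheaters.PMBaseModels
import Literature.IUT.HodgeTheaters.PMBaseStripsProofs

/-!
# Proofs over [IUTchI] Ex 6.3 (ii): the negative equivariance is NOT a consequence of the base interface

Mochizuki, *Inter-universal Teichmüller theory I*, §6, Example 6.3 (ii) p. 161, kurims manuscript
(May 2020). PROOF-ONLY companion (theorems, no definitions) to abc-iut-L5-t4's `PMBaseKitModel.lean` /
`PMBaseModels.lean`, by the L5 discharge seat abc-iut-L5-t13.

**Independence witness** (`Ex63.exists_kit_not_equivariant`): for every prime `l ≠ 2` there is a base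
kit `K : PMBaseKit l` with a valuation (abc-iut-L5-t4's toy collage kit with `φ^{Θell}_{•,v}` replaced by
the TRANSLATION `z ↦ z + 1` of `AGL₁(𝔽_l)`, all interface clauses still holding) over which the
equivariance `Ex63.Equivariant K (0, −1)` of Example 6.3 (ii) FAILS. Consequently the printed
"one verifies immediately that `φ^{Theta ell}_±` is equivariant" is, for negative elements, genuine input
about `φ^{Θell}_{•,v}` (the cusp `0` is fixed by the inversion) that the interface `PMBaseKit` does not
carry, and the conditional form of the discharges of Props 6.6 (ii), (iii), 6.8 (i) (hypothesis
`∀ γ, γ.IsNegative → Ex63.Equivariant K γ`) cannot be removed over the interface as it stands.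
Record only; [claim: Mochizuki2012, status: disputed]; nothing here takes a side on any disputed step.
-/

namespace Literature.IUT.HodgeTheaters

open CategoryTheory

namespace PMBaseKit

/-- **Ex 6.3 (ii) for negative elements is independent of the base interface**: a kit (with `𝕍 = Unit`)
over which `φ^{Θell}_±` is NOT equivariant for `(0, −1) ∈ 𝔽_l^{⋊±}`.
[claim: Mochizuki2012, status: disputed] -/
theorem Ex63.exists_kit_not_equivariant (l : ℕ) [Fact l.Prime] (hl : l ≠ 2) :
    ∃ K : PMBaseKit.{0} l, Nonempty K.V ∧ ¬ Ex63.Equivariant K (FlPM.mk 0 (-1)) := by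
  classical
  -- the translation `z ↦ z + 1` of `AGL₁(𝔽_l)`
  let φ₁ : Model.AGL l := ⟨Multiplicative.ofAdd 1, 1⟩
  have hφ₁ : ∀ z : ZMod l, Model.aglPerm l φ₁ z = z + 1 := fun z => by
    change ((1 : (ZMod l)ˣ) : ZMod l) * z + (Multiplicative.ofAdd (1 : ZMod l)).toAdd = z + 1
    simp
  let K : PMBaseKit.{0} l :=
    { PMBaseKit.toyKit l hl with
      phiEll := fun _ => φ₁
      labOfHom_phiEll_bijective := fun _ => (Model.homPerm l (X := .loc) (Y := .glob) φ₁).bijective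
      labOfHom_phiEll_charts := by
        rintro _ e ⟨ε, rfl⟩
        refine ⟨FlPM.mk (-(ε • (1 : ZMod l))) ε, ?_⟩
        ext z
        change (FlPM.mk (l := l) _ ε) • z = ε • (Equiv.ofBijective _ _).symm z
        generalize hw : (Equiv.ofBijective _ _).symm z = w
        rw [Equiv.symm_apply_eq] at hw
        change z = Model.homPerm l (X := .loc) (Y := .glob) φ₁ w at hw
        have hw' : z = w + 1 := by rw [hw]; exact hφ₁ w
        subst hw'
        simp only [FlPM.mk_smul, smul_add]
        abel }
  have hV : Nonempty K.V := ⟨(show K.V from ())⟩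
  refine ⟨K, hV, fun hE => ?_⟩
  obtain ⟨v⟩ := hV
  -- notation and basic values in `K`
  have hchart : ∀ z : ZMod l, K.gChart₀ z = z := fun z => by
    change FlPM.toPerm l 1 z = z
    simp
  have hphi : ∀ z : ZMod l, K.labOfHom v (K.phiEll v) z = z + 1 := hφ₁
  have hneg : ∀ z : ZMod l, labNeg (K.isLocal_model v) z = -z := by
    intro z
    obtain ⟨ε, hε⟩ : ∃ ε : ℤˣ, signPerm l ε = (K.labPM v (K.model v) (K.isLocal_model v)).chart₀ :=
      (K.labPM v (K.model v) (K.isLocal_model v)).chart₀_mem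
    change ((K.labPM v (K.model v) (K.isLocal_model v)).chart₀.trans ((signPerm l (-1)).trans
      (K.labPM v (K.model v) (K.isLocal_model v)).chart₀.symm)) z = -z
    rw [← hε]
    change (signPerm l ε).symm (signPerm l (-1) (signPerm l ε z)) = -z
    rw [Equiv.symm_apply_eq]
    simp [Units.smul_def, smul_neg]
  -- an element of the right-hand side of the equivariance at `t = 0`: `p_v ≫ φ^{Θell}`
  obtain ⟨p, hp⟩ := DStrip.exists_mem_signedPolyAut (DStrip.model K) (fun _ => (-1 : ℤˣ))
  have hpv : K.labMap v (p v) = labNeg (K.isLocal_model v) := by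
    rcases labMap_eq_refl_or_labNeg (K.isLocal_model v) (p v) with h | h
    · exact absurd (((DStrip.mem_signedPolyAut_iff _ _).mp hp v).mp h) (by decide)
    · exact h
  have hEq := hE 0 v
  change {h | ∃ f ∈ Ex63.poly K 0 v, ∃ b ∈ Ex63.lifts K (FlPM.mk 0 (-1)), h = f ≫ (K.atV v).map b.hom} =
    {h | ∃ q ∈ (DStrip.model K).signedPolyAut (fun _ => (FlPM.mk (l := l) 0 (-1)).right),
      ∃ g ∈ Ex63.poly K ((FlPM.mk (l := l) 0 (-1)) • (0 : ZMod l)) v, h = (q v).hom ≫ g} at hEq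
  have h0 : (FlPM.mk (l := l) 0 (-1)) • (0 : ZMod l) = 0 := by simp [FlPM.mk_smul]
  have hmem : (p v).hom ≫ K.phiEll v ∈ {h | ∃ q ∈ (DStrip.model K).signedPolyAut
      (fun _ => (FlPM.mk (l := l) 0 (-1)).right),
      ∃ g ∈ Ex63.poly K ((FlPM.mk (l := l) 0 (-1)) • (0 : ZMod l)) v, h = (q v).hom ≫ g} := by
    refine ⟨p, hp, K.phiEll v, ?_, rfl⟩
    rw [h0]
    refine ⟨Iso.refl _, (K.mem_autPlus_iff _).mpr (K.labMap_refl v _), Iso.refl _, ?_, by simp⟩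
    rw [Ex63.lifts_transl_zero]
    exact one_mem _
  rw [← hEq] at hmem
  obtain ⟨f, ⟨a, ha, b', hb', rfl⟩, b, hb, hfb⟩ := hmem
  -- read both sides on `±`-label classes, at the label `0`
  have hav : K.labMap v a = Equiv.refl _ := (K.mem_autPlus_iff a).mp ha
  have hL := congrArg (fun h => K.labOfHom v h (0 : ZMod l)) hfb
  simp only at hL
  rw [K.labOfHom_pre, Function.comp_apply, hpv, hneg, neg_zero, hphi, Category.assoc, Category.assoc,
    ← Functor.map_comp, ← Iso.trans_hom, K.labOfHom_pre, K.labOfHom_post, Function.comp_apply,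
    Function.comp_apply, hav, Equiv.refl_apply, hphi, K.gLabMap_trans, hb'.2, hb.2] at hL
  have hchart' : ∀ z : ZMod l, K.gChart₀.symm z = z := fun z => by
    rw [Equiv.symm_apply_eq]; exact (hchart z).symm
  simp only [Equiv.trans_apply, FlPM.toPerm_apply, FlPM.transl_smul, FlPM.mk_smul, hchart, hchart'] at hL
  -- `hL : 0 + 1 = -1 • (0 + 1 + 0) + 0` in `𝔽_l`, i.e. `2 = 0`
  have hL' : @Eq (ZMod l) _ _ := hL
  have h2 : (2 : ZMod l) = 0 := by
    simp only [Units.smul_def, Units.val_neg, Units.val_one, neg_smul, one_smul, add_zero] at hL'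
    linear_combination hL'
  have hdvd : l ∣ 2 := (ZMod.natCast_eq_zero_iff 2 l).mp (by exact_mod_cast h2)
  have hprime : l.Prime := Fact.out
  rcases (Nat.dvd_prime Nat.prime_two).mp hdvd with h1 | h2'
  · exact hprime.one_lt.ne' h1
  · exact hl h2'

end PMBaseKit

end Literature.IUT.HodgeTheaters
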